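import Literature.MathematicalPhysics.QuantumFieldTheory.Balaban1983to89.B11Eq13Concrete
import Literature.MathematicalPhysics.QuantumFieldTheory.Balaban1983to89.B11Rem278
import Literature.MathematicalPhysics.QuantumFieldTheory.Balaban1983to89.B11Eq20BoundB
import Literature.MathematicalPhysics.QuantumFieldTheory.Balaban1983to89.B11Eq22Remainder
import Literature.MathematicalPhysics.QuantumFieldTheory.Balaban1983to89.B11AxialTransport190
import Literature.MathematicalPhysics.QuantumFieldTheory.Balaban1983to89.B11Thm1
import Literature.MathematicalPhysics.QuantumFieldTheory.Balaban1983to89.B11Thm1Exact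
import Literature.MathematicalPhysics.QuantumFieldTheory.Balaban1983to89.B11Prop7Assembly
import Literature.MathematicalPhysics.QuantumFieldTheory.Balaban1983to89.B8Carve01SpacesHyp
import Literature.MathematicalPhysics.QuantumFieldTheory.Balaban1983to89.B8Eq119TwistedAxial
import Literature.MathematicalPhysics.QuantumFieldTheory.Balaban1983to89.B8SectAStatements

/-!
# `Balaban1983to89.B11Carve11IntroSectAHyp` — [B11] Introduction + Sect. A, pp. 277–281 (displays (1)–(23), Theorem 1
# p. 279, Proposition 2 p. 281): the CARVED hypothesis-form block file of P6 block 11 — every in-tree declaration of the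
# section CITED BY NAME (module-docstring tables + the kernel-resolved `recall` index of §4), the one printed DEFINITION of
# the page range with no declaration in the tree typed WITH BODY (the class of cubes □ of pp. 278–279, for a general domain
# sequence `{Ω_j}` with holes, on the `ℤᵈ` fine-site-set carrier of the [B8]/[B11] lineage) with its printed set identity
# PROVED, and ONE bundle `Hyp` of the section's printed assertions keyed to the consumer `stmt-QuantumFields-19200`

statement-level skeleton of published theorems with citation tags; proofs where landed; nothing here is a claim about
the Yang–Mills mass gap

CITATION HEADER (lean-in-tree rule 2026-08-18).  T. Bałaban, *The variational problem and background fields in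
renormalization group method for lattice gauge theories*, Commun. Math. Phys. **102** (1985) 277–309,
doi:10.1007/bf01229381 `[Balaban1985Variational]` (cell paper "B11"; its references "[3]" = `[Balaban1984PropagatorsII]`
(B6), "[4]" = `[Balaban1985Averaging]` (B7), "[5]" = `[Balaban1985BackgroundPropagators]` (B9), "[6]" =
`[Balaban1985RegularSpaces]` (B8)).  PDF held as text: `paper:balaban1985-cmp102-variational-background` (journal page = PDF
page + 276); pp. 277–281 [PDF 1–5] read this session on the text layer (`p0001.txt`–`p0005.txt`) AND, for every sentence
quoted below, AS IMAGES on the ×2/×4 renders `run/shared/lean/pub/pub-balaban/b2b-balaban-ref1/pages/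
1985-cmp102-variational-background/1985-cmp102-variational-background-p00N-x2.png` (N = 1, …, 5) and `-p003-x4.png` (p. 279).
Cell `lit-balaban` (HOME `run/shared/lean/pub/lit-balaban/`), P6 CARVING FAN (D-0154 (3b)), seat `lit-balaban-carve-11` =
BLOCK 11 of `carve/BLOCKS-11-20.md` (lead g30, SKELETON v3.368/v3.370; rules `carve/CARVE-RULES.md`): source section = [B11]
Intro + Sect. A, pp. 277–281, 22 SKELETON rows `B11.Thm1 … B11.Claim@279`, ALL with a landed declaration (typed-existing 15,
proved-existing 4, proved 3); KEY item `stmt-QuantumFields-19200` (R3 `MinimiserStabilityRegPr`), also-feeds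
`stmt-QuantumFields-20541`, `stmt-QuantumFields-20520`.  Filed `--supports stmt-QuantumFields-19200`; it closes no item,
moves no node count, and proves nothing about the summit.

## THE PRINTED TEXT USED HERE (verbatim; ×2/×4 renders)

p. 277 [PDF 1]: *"We assume that a sequence of domains Ω_j, j = 0, 1, …, k, is given, satisfying the following conditions:
Ω_j ⊂ T_η, Ω₀ ⊃ Ω₁ ⊃ ⋯ ⊃ Ω_k, Ω_j is a union of big block[s] of the size M₁Lʲη, (Lʲη)⁻¹dist(Ωᶜ_j, Ω_{j+1}) > RM₁, (1)
where R ≥ R₁, the numbers R₁, M₁ are fixed in such a way that all the results of [3, 5, 6] hold for these numbers. … The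
sets Λ_j and 𝔅_k are defined as Λ_j = Ω_j^{(j)}∖Ω_{j+1}^{(j)}, Ω_{k+1} = ∅, or Bʲ(Λ_j) = Ω_j∖Ω_{j+1}, 𝔅_k = ⋃_{j=0}^{k} Λ_j."*
pp. 278–279 [PDF 2–3]: *"We will prove also some local regularity properties of the minimal configurations. To formulate
them we have to introduce a class of cubes. This class was described in Sect. F [6]. Each cube □ of this class is contained
in Bʲ(Λ_j) ∪ B^{j+1}(Λ_{j+1}) = Ω_j∖Ω_{j+2} for some j between 0 and k, and is a union of big blocks of the L⁻ʲ-lattice.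
More exactly we assume that □ has a size 2MLʲη, where M is a multiple of R₁M₁, and that the
cube □̃ of the size (2M + 4R₁M₁)Lʲη and with the same center as □, is contained in Bʲ(Λ_j) ∪ B^{j+1}(Λ_{j+1}), but not in
B^{j+1}(Λ_{j+1}). We consider all cubes □ satisfying the above conditions."*  Theorem 1 p. 279: *"… for an arbitrary cube
□ in the class described above, of a size 2MLʲη, M ≤ M(ε₁), there exists a gauge transformation u defined on a
neighborhood of □ and such that on □, [(9), (10)] … More exactly M(ε₁) = R₁M₁(a₁/ε₁)."*

## IN TREE — THE 22 ROWS OF BLOCK 11, CITED BY NAME (never restated; `recall`ed in §4 where the module is imported)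

| row | item (page) | in-tree declaration(s) |
|---|---|---|
| B11.Eq1 | (1) + Λ_j, 𝔅_k (277) | `B8ConstraintBonds.DomainSeq` (nesting / block saturation / separation collar), `B8ConstraintBonds.Lam`, `.Bk`; fine layers `B8Ineq132.layer` (= Bʲ(Λ_j) = Ω_j∖Ω_{j+1}); level coordinates `B11Eq7Convention.Lam`; the metric clause «(Lʲη)⁻¹dist(Ωᶜ_j, Ω_{j+1}) > RM₁» `B8SectAStatements.MetricClause14`, «R ≥ R₁» as monotonicity `B8SectAStatements.metricClause14_anti`; (1.3)–(1.4) record `B8Eq134Admissible.Admissible134`; bond/plaquette convention «at least one end-point / corner» `B8Ineq132.BondTouches`, `.PlaqTouches` |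
| B11.Eq2 | (2) 𝔘_k({Ω_j}, ε₀) (278) | `B8Ineq132.InAk` (= 𝔄_k of [6] (1.7)–(1.9)), abstract `B11.VarProblem.InU`; T³: `T3PrintedRegularMinimiser.RegPr` (both clauses) |
| B11.Eq3 | (3) 𝔅_k(𝔅_k, V) (278) | `B11Eq7Convention.InB` (literal bonds), `B8Eq113ClassBk.InBk`, abstract `B11.VarProblem.InB` |
| B11.Eq4 | (4) the gauge group (278) | `B8ConstraintBonds.ResGauge` (= [6] (1.14)), as a subgroup `B8Carve01SpacesHyp.resGaugeSubgroup`; V1 `B6MinimalOrbitV1.SameOrbit`; T³: `T3SectALandauChart.descTransf_inv/_mul/_one` (the group (4) proved) |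
| B11.Eq5 | (5) the functional (278) | torus Wilson action `wilsonAction4`/`wilsonAction` (`Setup.lean`), its invariance `T4WilsonGaugeFlatDirection.wilsonAction_gaugeAct`, `B14Eq16FaddeevPopov.wilsonAction4_gaugeAct'`; abstract quadratic model `B6Eq218Lagrangian.IsCritical` |
| B11.Eq6 | (6), «critical orbit», «minimal orbit» (278) | `B11Eq7Convention.concreteVarProblem` (fields `OnMinimalOrbit`, `UniqueCriticalOrbit` of `B11.VarProblem`); T³: `T3PrintedRegularMinimiser.regFibrePr` (the space (6)), `T3PrintedMinimiserExistence.Thm1GlobalMinAt` |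
| B11.Eq7 | (7) + boundary convention (278) | `B11Eq7Convention.effCfg`, `.PlaqB`, `.Reg7`; abstract `B11.VarProblem.Reg7` |
| B11.Rem@278 | «(7) with ε₁ = O(ε₀)» (278) | `B11.Prop2OfB7Shape` (typed shape), PROVED `B11Rem278.prop2OfB7Shape_concrete` / `_unitaryUnits` / `_unitaryGroup` (via `reg7_of_nonempty`) |
| B11.Def@278 | class of cubes □ (278–279) | abstract data `B11.VarProblem.Cube/scale/sizeM`; NODE 00's no-holes torus class `Node00.B11CubeIdx`, `Node00.cubesOfRecordT` (`Node00/CarriersZRegCubes.lean`) — the GENERAL class (holes, any `{Ω_j}`) is typed WITH BODY in §1 below |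
| B11.Def@279 | U_k(V) (279) | `IsBackground`, `Background` (`Setup.lean` §12); `B11.VarProblem.OnMinimalOrbit` |
| B11.Thm1 | Theorem 1 (279) | `B11.Thm1Printed`; with «M(ε₁) = R₁M₁(a₁/ε₁)» `B11Thm1Exact.Thm1PrintedExact` (`thm1Printed_of_exact`); clauses `B11Thm1.Exists8`, `.Unique6`, `.Ineq9`, `.Ineq10`, `.Reg910`, `.Consts`, `.Thm1At` (`regularity_iff`, `thm1Printed_iff`); `B11.Regularity`; NODE 00 / T³ readings `Node00.VariationalThm1RegSepPrinted(Co)`, `Node00.B11CubeNumerics.MfunPrinted`, `T3PrintedMinimiserExistence.Thm1GlobalMinAt/Thm1GlobalMin/Thm1MinimalIn8At`, `B11Reg910Classes.Reg910Cube` |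
| B11.Claim@279 | induction on k (279–280) | `B11Thm1.thm1At_allLevels`, `.thm1Printed_allLevels`, `.thm1Printed_level`, `.background_of_thm1At` over `B11Thm1.Tower` |
| B11.Eq11 | Sect. A (11), V₀ (279) | leaf `B11Thm1.StepA11` (GAPS G-B11-A1 «easily construct»); 𝔅′_{k−1} = level sets `B11Eq7Convention.Lam L Ω (k−1) ·` (`B11Eq13Concrete` (M8), `lam_succ_subset`) |
| B11.Eq12 | (12)–(13) (280) | PROVED `B11Eq13Concrete.step13` (`inAk_succ`, `inB_succ`), `step13_concrete`; leaf `B11Thm1.StepA13` + arithmetic `B11Thm1.ineq13_plaquette_factor/ineq13_bond_factor/sq_le_cube_of_one_le` |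
| B11.Eq14 | (14); «with C₁ = L³»; k = 1 (280) | `B11Eq13Concrete.sat14_L3`, `.sat14_of_12`; `B11Thm1.VarProblemA.Sat14`, `B11.LGData.Sat14`, T³ `T3SectALandauChart.Sat14T3`; k = 1 leaf `B11Thm1.BaseK1` (GAPS G-B11-A2) |
| B11.Eq15 | (15)–(17) (280) | (15) `B8Lemma1NonAbelian.pert` (U′ = UU₀⁻¹), `B8Eq119TwistedAxial.mulCfg_pert`; (16) = [6] (1.17) `B8Eq119TwistedAxial.eq117`, `B11AxialTransport190.relAct` (`relAct_mul_bg`, `relAct_mul`); (17) = [6] (1.18) `B8Eq119TwistedAxial.eq118`; T³ `T3SectALandauChart.pert/emb15/act16/act16_eq` |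
| B11.Eq18 | (18) (280) | `B11.LGData.In18`; ℤᵈ class (1.28) `B8Eq113ClassBk.Class128`, axial gauge `B8Eq119TwistedAxial.InAx` (= [6] (1.19)), gauge fixing `twistedFix_global`, `twistedFix_unique_normalised`; the reduction sentence «it is enough to consider it on the space (18)» = located law `B11Prop7Assembly.Bridge.Laws.gaugeFix`, T³ `T3SectALandauChart.AxialRepr`, `isCritR2_gaugeAct_of_trivial` |
| B11.Claim@280 | Landau gauge via [6] Thm 2 (280–281) | PROVED edge `B11.p280_landau_gauge_of_B8Thm2` (from `B8.Thm2Printed` + the [6] Sect. F regularity implication, cf. `B8.Prop6Printed`); «(1.35) with α₁ = C₁ε₁» `B11Eq20BoundB.ineq135_of_inB`; «(thus u = 1 on Λ₀)» `B8Eq119TwistedAxial.restr129_level_zero`; (1.29) `B8Eq119TwistedAxial.Restr129`, `B11.LGData.Restricted` (GAPS G-B11-A4: α₀ = ε₀ for U₀ needs C₁B₃ε₁ ≤ ε₀) |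
| B11.Eq19 | (19)–(21), «\|B\| < 2dLC₁ε₁», «ε₂ ≥ B₁(ε₀ + C₁ε₁)» (281) | `B11.LGData.In19_21`; PROVED `B11Eq20BoundB.ineq20`, `.ineq20_tilde`; T³ with body `T3SectALandauChart.In19`; the threshold is a binder of `B11.Prop2Printed` (`B11Prop7Assembly.eps2_ge_prop2`) |
| B11.Prop2 | Proposition 2 (281) | `B11.Prop2Printed`; T³ native `T3SectALandauChart.Prop2NativeAt` (`prop2Printed_famLG3_iff_native`); «the above mapping is one-to-one» = located law `B11Prop7Assembly.Bridge.Laws.orbit16` (LQB reading), T³ `T3SectALandauChart.Orbit16` |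
| B11.Claim@281 | Thm 1 ⇐ Prop 7 ∧ Prop 8 ∧ Sect. F (281, 299, 304–305) | PROVED `B11.thm1_of_prop7_prop8_sectF`, `B11Thm1Exact.thm1Exact_of_prop7_prop8_sectF`; «exactly one critical configuration» `B11.axial_critical_from_one_landau`, `B11Prop7Assembly.one_landau_of_props`, `.atMostOneCriticalOrbit_of_props` |
| B11.Eq22 | (22)–(23) (281) | PROVED `B11Eq22Remainder.expRemainder` (R_n), `exp_eq_taylor_four` ((22)), `norm_expRemainder_I_smul_le_one` (\|R_n(iX)\| ≤ 1, X hermitian), `norm_expRemainder_le_exp_norm` (\|R_n(X)\| ≤ e^{\|X\|}) |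

## THE UNNUMBERED SENTENCES OF pp. 277–281 — census (every asserting sentence → its decl, or typed here, or zero weight)

* p. 278 «The space 𝔘_k({Ω_j}, ε₀) is gauge invariant, and the space 𝔅_k(𝔅_k, V) is invariant with respect to gauge
  transformations u satisfying u(y) = 1 for y ∈ 𝔅_k. (4)» — `B8Ineq132.inAk_gaugeAct_iff`; `B8Eq113ClassBk.inBkOn_gaugeAct_of_resGauge`
  with the located gap G-adv8-10 for the literal one-end-point bonds (`B8ConstraintBonds.literal_not_Invariant`, `bondsB_invariant`) — CITED.
* p. 278 «This space and the action (5) are invariant with respect to the gauge transformations (4). These transformations form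
  a group and the space (6) is a union of orbits of this group.» — `B8Carve01SpacesHyp.resGaugeSubgroup` / `ResGaugeSubgroupPrinted`
  (group), `B8Carve01SpacesHyp.inAk_iff_of_orbitRel114` (orbits), torus `T4WilsonGaugeFlatDirection.wilsonAction_gaugeAct`,
  T³ `T3PrintedRegularOrbits.regPr_gaugeAct_iff`, `gaugeAct_mem_regFibrePr_iff_of_trivial` ((6) is (4)-invariant) — CITED.
* p. 278 «for ε₀ sufficiently small there is at most one critical orbit» / «for ε₁ sufficiently small there exists a critical
  orbit … a minimal orbit. Elements of the minimal orbit are called minimal configurations» — the two clauses of Theorem 1 /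
  Prop. 7 (`B11Thm1.Unique6`, `.Exists8`, `B11.VarProblemX.AtMostOneCriticalOrbit`, `B11.Prop7Printed`) — CITED.
* p. 279 «The constants a₀, a₁, B₃, depend on d and L only, the constants B₄(β₀), M(ε₁) depend on the indicated parameters
  also. More exactly M(ε₁) = R₁M₁(a₁/ε₁).» — quantifier order of `B11.Thm1Printed` (constants before the instance) and the
  exact ceiling of `B11Thm1Exact.Thm1PrintedExact` — CITED (bundle member below).  «Minimal configurations will be denoted by
  U_k(V), or U_k» — notation (`IsBackground`).  «we will prove that they are analytic functions of V … we defer their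
  formulations to the last section» — `B11.Prop9Printed` (block 16) — CITED.
* p. 279 «Theorem 1 will be proved by induction with respect to k. … for k = 1, will be covered by the proof of a general
  case.» — `B11Thm1.thm1At_allLevels` — CITED.  p. 280 «hence U₀ should be close to the minimal configuration we are
  looking for» — heuristic, zero weight.
* p. 280 «We assume that the numbers a₀, a₁ are so small that all the theorems of the papers [4, 6] are valid for the
  configurations U, U₀.» — standing smallness convention; its explicit content is the thresholds carried by the typed
  statements (`B11.Prop2Printed`: «ε₀ + C₁ε₁ ≤ c₁»; `B11Prop7Assembly.silent_restrictions`) — zero weight (reading rule).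
* p. 280/281 the axial gauge fixing, [6] Thm 2 with α₀ = ε₀, α₁ = C₁ε₁, «exactly one gauge transformation u», (19)–(21),
  «one-to-one», «reduced … to the space of configurations U₁U₀ satisfying (19)–(21)» — rows B11.Eq18, B11.Claim@280,
  B11.Eq19, B11.Prop2 above — CITED (the literal injectivity sentence is carried by the tree as the located law `orbit16`
  in the reading its consumers use; it is NOT re-typed here).
* p. 281 «In the next four sections … there exists exactly one critical configuration, which is a minimum of the functional
  (5). This will prove Theorem 1 with worse bounds.» — `B11.axial_critical_from_one_landau`, `B11.Prop6Printed`,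
  `B11.Prop7Printed`, `B11.thm1_of_prop7_prop8_sectF` — CITED.
* pp. 278–279 THE CLASS OF CUBES □ — no declaration with body for a general `{Ω_j}` (the tree: abstract `Cube` type of
  `B11.VarProblem`; `Node00.B11CubeIdx` for NODE 00's no-holes tori only, whose header records «the general (holes) class …
  is NOT typed») — TYPED HERE, §1.

## WHAT THIS FILE ADDS (0 sorry; every `def` has its body; no instance / notation / attribute)

§1 THE CLASS OF CUBES of pp. 278–279 on the `ℤᵈ` fine-site-set carrier of `B8Ineq132` / `B11Eq7Convention` (`Site d = ℤᵈ`,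
   `Ω : ℕ → Set (Site d)` the domains as fine site sets, `Bʲ(Λ_j) = B8Ineq132.layer Ω k j`): `fineBox` (lattice box),
   `cubeLo`/`cubeSide`/`cubeCollar` (□'s lower corner `Lʲ·M₁·c`, side `2MLʲ`, `M = n·R₁M₁`; collar `2R₁M₁Lʲ`), `cubeSet` (□),
   `cubeEnlSet` (□̃, side `(2M + 4R₁M₁)Lʲ`, same centre), `twoLayers` (Bʲ(Λ_j) ∪ B^{j+1}(Λ_{j+1}) with print's «Ω_{k+1} = ∅»
   built in), **`IsClassCube L k Ω R₁ M₁ j n c`** (the printed membership condition, with body), the packaged type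
   `ClassCube` with print's `scale` (= j), `sizeM` (= M) and carriers; PROVED: □ ⊆ □̃ (`cubeSet_subset_cubeEnlSet`), the printed
   side arithmetic (`cubeSide_add_two_collar`), print's «=» in «Bʲ(Λ_j) ∪ B^{j+1}(Λ_{j+1}) = Ω_j∖Ω_{j+2}» under the nesting of
   (1) and the convention Ω_m = ∅ (m > k) (`twoLayers_eq_diff`), hence «each cube □ of this class is contained in
   Ω_j∖Ω_{j+2}» (`IsClassCube.cubeSet_subset_diff`), the top-scale reading (`isClassCube_top_iff`: at j = k the class is
   every □ with □̃ ⊂ Ω_k — NODE 00's reading D-defB11-5, recovered), non-vacuity (`isClassCube_top_univ`), `sizeM > 0`,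
   □ ≠ ∅.
§2 THE BUNDLE `Hyp R₁M₁ B₁ B₃ C₁ c₁ fam famLG` = Theorem 1 WITH its last sentence (`B11Thm1Exact.Thm1PrintedExact R₁M₁ fam`)
   ∧ the remark after (7) (`B11.Prop2OfB7Shape fam`) ∧ Proposition 2 (`B11.Prop2Printed B₁ B₃ C₁ c₁ famLG`), BY NAME over
   the tree's carriers (`fam : I → B11.VarProblem`, the Sect. A–E descriptions `famLG : I → B11.LGData`), keyed to
   `stmt-QuantumFields-19200`; projections; the derived tree forms `Hyp.thm1Printed` (`B11.Thm1Printed`), `Hyp.thm1At`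
   (`∃ C : B11Thm1.Consts, ∀ i, B11Thm1.Thm1At C (fam i)`); and `hyp_concrete` — at the concrete family
   `B11Eq7Convention.concreteVarProblem d 𝔸 L G X` (`L ≥ 2`, `AvgClosed` gauge group) the middle member is the tree's
   THEOREM `B11Rem278.prop2OfB7Shape_concrete`, so the bundle there is Theorem 1 ∧ Proposition 2.
§4 the `recall` index (no declaration; the kernel checks that every cited name of the lineage modules exists).

## HONEST SCOPE / DECLARED READINGS

* D-c11-1 «GRID»: «□ … is a union of big blocks» is read as: □'s lower corner lies on the big-block grid `M₁Lʲη·ℤᵈ` of the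
  `Lʲη`-lattice anchored at the origin (the blocks of (1) «Ω_j is a union of big blocks of the size M₁Lʲη»; NODE 00's
  D-defB11-5-2) — index `c : ℤᵈ`, fine corner `Lʲ·M₁·c`; the side `2M·Lʲ` with `M = n·R₁M₁`, `n ≥ 1`, is automatically a
  multiple of the block side.  Print's «big blocks of the L⁻ʲ-lattice» (p. 279 l. 2; the notation of [6] p. 98 «the big
  blocks of the lattice T_{L⁻ʲ}») is read as the big blocks of side `M₁Lʲη` of (1) at the scale `j` of «a size 2MLʲη» in the
  same sentence.
* D-c11-2 «FINE SITE SETS»: □, □̃, Bʲ(Λ_j) are typed as sets of sites of the fine lattice `T_η ↦ ℤᵈ` (deviation (M1) of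
  `B11Eq7Convention`: no torus); half-open lattice boxes as the blocks (2) of [4]; «contained in» = `⊆` of site sets.
* D-c11-3 «Ω_{k+1} = ∅»: built into `twoLayers` / `IsClassCube` (for j = k the second layer is absent and «not in
  B^{k+1}(Λ_{k+1}) = ∅» is automatic), NOT imposed on the datum `Ω` (the lineage's `GeomDatum` does not impose it either);
  `twoLayers_eq_diff` displays it as the hypothesis `htail`.
* NOT typed: the orbit notions «critical/minimal orbit» with body on `ℤᵈ` (the action (5) is a finite sum only on a
  torus: `wilsonAction4`, T³ `Thm1GlobalMinAt`); the printed recipe for V₀ in (11) and its property «(7) on 𝔅′_{k−1}»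
  (leaf `B11Thm1.StepA11`, GAPS G-B11-A1 — not analysed here); the literal injectivity sentence of p. 281 (see census).
* `Hyp` is a HYPOTHESIS bundle: Theorem 1 and Proposition 2 are the paper's theorems, used downstream only as `(h : Hyp …)`;
  nothing of [B11] is asserted.  Desk stems (`Node00/*`, `T3*`, `T4*`, `B11Thm1*`, `B11Leaf*`, decade-1 list) are cited,
  not imported (except `B11Thm1`, `B11Thm1Exact`, cited BY NAME as the rules require) and not declared into.  No summit
  statement is proved by this file.
-/

noncomputable section

namespace Literature.MathematicalPhysics.QuantumFieldTheory.Balaban1983to89.B11Carve11IntroSectAHyp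

open B8Ineq132 (layer)

-- `Site` alone would resolve to the torus sites of `Setup.lean`; the `ℤᵈ` sites `B7Prop1Explicit.Site d = Fin d → ℤ` of the
-- lineage (`B8Ineq132`, `B11Eq7Convention`) are written in full (no alias is exported).
variable {d : ℕ}

/-! ## §1 The class of cubes □ of pp. 278–279 (row B11.Def@278), with body, for a general domain sequence `{Ω_j}` -/

section CubeClass

/-- The lattice box of `ℤᵈ` with lower corner `a` and `s` sites per side, `{z | a_i ≤ z_i < a_i + s}` (half-open, as the
blocks (2) of [4]; NODE 00's `boxZ`). [cite: Balaban1985Variational, pp.278–279 («□ has a size 2MLʲη»); Balaban1985Averaging, (2) p.17] -/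
def fineBox (a : B7Prop1Explicit.Site d) (s : ℕ) : Set (B7Prop1Explicit.Site d) :=
  {z | ∀ i, a i ≤ z i ∧ z i < a i + s}

/-- Membership in a lattice box. [cite: Balaban1985Variational, pp.278–279] -/
theorem mem_fineBox_iff (a : B7Prop1Explicit.Site d) (s : ℕ) (z : B7Prop1Explicit.Site d) : z ∈ fineBox a s ↔ ∀ i, a i ≤ z i ∧ z i < a i + s :=
  Iff.rfl

/-- The lower corner belongs to a box of positive side. [cite: Balaban1985Variational, pp.278–279] -/
theorem self_mem_fineBox (a : B7Prop1Explicit.Site d) {s : ℕ} (hs : 0 < s) : a ∈ fineBox a s := by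
  intro i
  have h : (0 : ℤ) < (s : ℤ) := by exact_mod_cast hs
  exact ⟨le_rfl, by linarith⟩

/-- A box lies in the box with the same centre enlarged by a collar `c` on every side. [cite: Balaban1985Variational, p.279 («with the same center as □»)] -/
theorem fineBox_subset_collar (a : B7Prop1Explicit.Site d) (s c : ℕ) : fineBox a s ⊆ fineBox (fun i => a i - c) (s + 2 * c) := by
  intro z hz i
  obtain ⟨h1, h2⟩ := hz i
  have hc : (0 : ℤ) ≤ c := by exact_mod_cast Nat.zero_le c
  refine ⟨by linarith, ?_⟩
  push_cast
  linarith

/-- **The lower corner of □** in fine sites: `Lʲ·M₁·c` for the big-block index `c ∈ ℤᵈ` (reading D-c11-1: «□ … is a union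
of big blocks» of the `Lʲη`-lattice, big blocks of side `M₁Lʲη` as in (1)). [cite: Balaban1985Variational, pp.278–279] -/
def cubeLo (L M₁ j : ℕ) (c : B7Prop1Explicit.Site d) : B7Prop1Explicit.Site d := fun i => ((L : ℤ) ^ j * M₁) * c i

/-- **The side of □** in fine sites: `2M·Lʲ` with `M = n·R₁M₁` («□ has a size 2MLʲη, where M is a multiple of R₁M₁»).
[cite: Balaban1985Variational, p.279] -/
def cubeSide (L R₁ M₁ j n : ℕ) : ℕ := 2 * (n * (R₁ * M₁)) * L ^ j

/-- **The collar of □̃** in fine sites: `2R₁M₁·Lʲ` on every side (□̃ has «the size (2M + 4R₁M₁)Lʲη and … the same center as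
□»). [cite: Balaban1985Variational, p.279] -/
def cubeCollar (L R₁ M₁ j : ℕ) : ℕ := 2 * (R₁ * M₁) * L ^ j

/-- **□ as a set of fine sites**: the box with lower corner `cubeLo` and side `cubeSide` (reading D-c11-2).
[cite: Balaban1985Variational, pp.278–279] -/
def cubeSet (L R₁ M₁ j n : ℕ) (c : B7Prop1Explicit.Site d) : Set (B7Prop1Explicit.Site d) :=
  fineBox (cubeLo L M₁ j c) (cubeSide L R₁ M₁ j n)

/-- **□̃ as a set of fine sites**: «the cube □̃ of the size (2M + 4R₁M₁)Lʲη and with the same center as □».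
[cite: Balaban1985Variational, p.279] -/
def cubeEnlSet (L R₁ M₁ j n : ℕ) (c : B7Prop1Explicit.Site d) : Set (B7Prop1Explicit.Site d) :=
  fineBox (fun i => cubeLo L M₁ j c i - cubeCollar L R₁ M₁ j) (cubeSide L R₁ M₁ j n + 2 * cubeCollar L R₁ M₁ j)

/-- □ ⊆ □̃. [cite: Balaban1985Variational, p.279] -/
theorem cubeSet_subset_cubeEnlSet (L R₁ M₁ j n : ℕ) (c : B7Prop1Explicit.Site d) :
    cubeSet L R₁ M₁ j n c ⊆ cubeEnlSet L R₁ M₁ j n c :=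
  fineBox_subset_collar _ _ _

/-- The printed side arithmetic: side of □ plus two collars = `(2M + 4R₁M₁)Lʲ`, `M = n·R₁M₁`.
[cite: Balaban1985Variational, p.279 («of the size (2M + 4R₁M₁)Lʲη»)] -/
theorem cubeSide_add_two_collar (L R₁ M₁ j n : ℕ) :
    cubeSide L R₁ M₁ j n + 2 * cubeCollar L R₁ M₁ j = (2 * (n * (R₁ * M₁)) + 4 * (R₁ * M₁)) * L ^ j := by
  unfold cubeSide cubeCollar
  ring

/-- The side of □ is positive for `L, R₁, M₁, n ≥ 1`. [cite: Balaban1985Variational, p.279] -/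
theorem cubeSide_pos {L R₁ M₁ j n : ℕ} (hL : 0 < L) (hR : 0 < R₁) (hM : 0 < M₁) (hn : 0 < n) :
    0 < cubeSide L R₁ M₁ j n :=
  Nat.mul_pos (Nat.mul_pos two_pos (Nat.mul_pos hn (Nat.mul_pos hR hM))) (pow_pos hL j)

/-- □ contains its lower corner (□ ≠ ∅) for `L, R₁, M₁, n ≥ 1`. [cite: Balaban1985Variational, p.279] -/
theorem cubeLo_mem_cubeSet {L R₁ M₁ j n : ℕ} (hL : 0 < L) (hR : 0 < R₁) (hM : 0 < M₁) (hn : 0 < n) (c : B7Prop1Explicit.Site d) :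
    cubeLo L M₁ j c ∈ cubeSet L R₁ M₁ j n c :=
  self_mem_fineBox _ (cubeSide_pos hL hR hM hn)

/-- **`Bʲ(Λ_j) ∪ B^{j+1}(Λ_{j+1})` as a set of fine sites** (`Bʲ(Λ_j) = Ω_j∖Ω_{j+1}` = `B8Ineq132.layer Ω k j`), with print's
convention «Ω_{k+1} = ∅» (p. 277) built in: for `j = k` the second member is absent (reading D-c11-3).
[cite: Balaban1985Variational, p.277 («Bʲ(Λ_j) = Ω_j∖Ω_{j+1}», «Ω_{k+1} = ∅»), p.279] -/
def twoLayers (Ω : ℕ → Set (B7Prop1Explicit.Site d)) (k j : ℕ) : Set (B7Prop1Explicit.Site d) :=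
  {x | x ∈ layer Ω k j ∨ (j + 1 ≤ k ∧ x ∈ layer Ω k (j + 1))}

/-- Unfolding of `twoLayers`. [cite: Balaban1985Variational, p.279] -/
theorem mem_twoLayers_iff (Ω : ℕ → Set (B7Prop1Explicit.Site d)) (k j : ℕ) (x : B7Prop1Explicit.Site d) :
    x ∈ twoLayers Ω k j ↔ x ∈ layer Ω k j ∨ (j + 1 ≤ k ∧ x ∈ layer Ω k (j + 1)) :=
  Iff.rfl

/-- `Bʲ(Λ_j) ⊆ Bʲ(Λ_j) ∪ B^{j+1}(Λ_{j+1})`. [cite: Balaban1985Variational, p.279] -/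
theorem layer_subset_twoLayers (Ω : ℕ → Set (B7Prop1Explicit.Site d)) (k j : ℕ) : layer Ω k j ⊆ twoLayers Ω k j :=
  fun _ h => Or.inl h

/-- **Print's «=» in «Bʲ(Λ_j) ∪ B^{j+1}(Λ_{j+1}) = Ω_j∖Ω_{j+2}»** (p. 279), PROVED for `j ≤ k` from the nesting
`Ω₀ ⊃ Ω₁ ⊃ ⋯ ⊃ Ω_k` of (1) (`hanti`, the field `anti` of `B8ConstraintBonds.DomainSeq`) and the convention `Ω_m = ∅` for
`m > k` («Ω_{k+1} = ∅», p. 277; `htail`). [cite: Balaban1985Variational, p.277 (1), p.279] -/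
theorem twoLayers_eq_diff {Ω : ℕ → Set (B7Prop1Explicit.Site d)} {k j : ℕ} (hanti : ∀ n, Ω (n + 1) ⊆ Ω n)
    (htail : ∀ m, k < m → Ω m = ∅) (hj : j ≤ k) : twoLayers Ω k j = Ω j \ Ω (j + 2) := by
  ext x
  simp only [twoLayers, layer, Set.mem_setOf_eq, Set.mem_sdiff]
  constructor
  · rintro (⟨hxj, hnot⟩ | ⟨hjk, hxj1, hnot⟩)
    · refine ⟨hxj, fun hx2 => ?_⟩
      rcases lt_or_eq_of_le hj with hlt | rfl
      · exact hnot hlt (hanti (j + 1) hx2)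
      · have h0 : Ω (j + 2) = ∅ := htail (j + 2) (by omega)
        rw [h0] at hx2
        exact hx2
    · refine ⟨hanti j hxj1, fun hx2 => ?_⟩
      rcases lt_or_eq_of_le hjk with hlt | heq
      · exact hnot hlt hx2
      · have h0 : Ω (j + 2) = ∅ := htail (j + 2) (by omega)
        rw [h0] at hx2
        exact hx2
  · rintro ⟨hxj, hx2⟩
    by_cases hx1 : x ∈ Ω (j + 1)
    · refine Or.inr ⟨?_, hx1, fun _ => hx2⟩
      by_contra hjk
      have h0 : Ω (j + 1) = ∅ := htail (j + 1) (by omega)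
      rw [h0] at hx1
      exact hx1
    · exact Or.inl ⟨hxj, fun _ => hx1⟩

/-- **THE CLASS OF CUBES □ of pp. 278–279** (row B11.Def@278), verbatim: *"Each cube □ of this class is contained in
Bʲ(Λ_j) ∪ B^{j+1}(Λ_{j+1}) = Ω_j∖Ω_{j+2} for some j between 0 and k, and is a union of big blocks of the L⁻ʲ-lattice. More
exactly we assume that □ has a size 2MLʲη, where M is a multiple of R₁M₁, and that the cube □̃ of the size (2M + 4R₁M₁)Lʲη
and with the same center as □, is contained in Bʲ(Λ_j) ∪ B^{j+1}(Λ_{j+1}), but not in B^{j+1}(Λ_{j+1}). We consider all cubes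
□ satisfying the above conditions."* — WITH BODY on the `ℤᵈ` fine-site-set carrier (`Ω : ℕ → Set (B7Prop1Explicit.Site d)` the domains of
(1) as fine site sets, `Bʲ(Λ_j) = B8Ineq132.layer Ω k j`): the cube with scale `j ≤ k`, big-block corner index `c` and
multiplicity `n ≥ 1` (`M = n·R₁M₁`) belongs to the class iff □̃ ⊆ Bʲ(Λ_j) ∪ B^{j+1}(Λ_{j+1}) and □̃ ⊄ B^{j+1}(Λ_{j+1})
(readings D-c11-1/2/3 of the module docstring).  The abstract `Cube` of `B11.VarProblem` and NODE 00's no-holes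
`Node00.B11CubeIdx` are the tree's other carriers of this class. [cite: Balaban1985Variational, pp.278–279 (the class of cubes □)] -/
def IsClassCube (L k : ℕ) (Ω : ℕ → Set (B7Prop1Explicit.Site d)) (R₁ M₁ : ℕ) (j n : ℕ)
    (c : B7Prop1Explicit.Site d) : Prop :=
  j ≤ k ∧ 1 ≤ n ∧ cubeEnlSet L R₁ M₁ j n c ⊆ twoLayers Ω k j ∧
    ¬ (j + 1 ≤ k ∧ cubeEnlSet L R₁ M₁ j n c ⊆ layer Ω k (j + 1))

/-- Unfolding of `IsClassCube`. [cite: Balaban1985Variational, pp.278–279] -/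
theorem isClassCube_iff (L k : ℕ) (Ω : ℕ → Set (B7Prop1Explicit.Site d)) (R₁ M₁ : ℕ) (j n : ℕ)
    (c : B7Prop1Explicit.Site d) :
    IsClassCube L k Ω R₁ M₁ j n c ↔
      j ≤ k ∧ 1 ≤ n ∧ cubeEnlSet L R₁ M₁ j n c ⊆ twoLayers Ω k j ∧
        ¬ (j + 1 ≤ k ∧ cubeEnlSet L R₁ M₁ j n c ⊆ layer Ω k (j + 1)) :=
  Iff.rfl

/-- «Each cube □ of this class is contained in Bʲ(Λ_j) ∪ B^{j+1}(Λ_{j+1})» (□ ⊆ □̃ ⊆ …). [cite: Balaban1985Variational, p.279] -/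
theorem IsClassCube.cubeSet_subset_twoLayers {L k : ℕ} {Ω : ℕ → Set (B7Prop1Explicit.Site d)} {R₁ M₁ j n : ℕ}
    {c : B7Prop1Explicit.Site d} (h : IsClassCube L k Ω R₁ M₁ j n c) : cubeSet L R₁ M₁ j n c ⊆ twoLayers Ω k j :=
  (cubeSet_subset_cubeEnlSet L R₁ M₁ j n c).trans h.2.2.1

/-- «… = Ω_j∖Ω_{j+2}»: for a nested sequence with `Ω_m = ∅` (m > k), each cube □ of the class at scale `j` is contained in
`Ω_j∖Ω_{j+2}`. [cite: Balaban1985Variational, p.279] -/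
theorem IsClassCube.cubeSet_subset_diff {L k : ℕ} {Ω : ℕ → Set (B7Prop1Explicit.Site d)} {R₁ M₁ j n : ℕ}
    {c : B7Prop1Explicit.Site d} (h : IsClassCube L k Ω R₁ M₁ j n c) (hanti : ∀ m, Ω (m + 1) ⊆ Ω m) (htail : ∀ m, k < m → Ω m = ∅) :
    cubeSet L R₁ M₁ j n c ⊆ Ω j \ Ω (j + 2) := by
  rw [← twoLayers_eq_diff hanti htail h.1]
  exact h.cubeSet_subset_twoLayers

/-- The nesting hypothesis of `twoLayers_eq_diff` is the field `anti` of the lineage's admissibility record (1) =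
`B8ConstraintBonds.DomainSeq` ((1.3)–(1.4) of [6]). [cite: Balaban1985Variational, (1) p.277] -/
theorem IsClassCube.cubeSet_subset_diff_of_domainSeq {L k : ℕ} {Ω : ℕ → Set (B7Prop1Explicit.Site d)}
    {R₁ M₁ j n : ℕ} {c : B7Prop1Explicit.Site d} (h : IsClassCube L k Ω R₁ M₁ j n c) (hΩ : B8ConstraintBonds.DomainSeq L Ω) (htail : ∀ m, k < m → Ω m = ∅) :
    cubeSet L R₁ M₁ j n c ⊆ Ω j \ Ω (j + 2) :=
  h.cubeSet_subset_diff hΩ.anti htail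

/-- **The top scale `j = k`**: `B^{k+1}(Λ_{k+1}) = ∅`, so the class at scale `k` is every cube (n ≥ 1) with □̃ ⊆ Bᵏ(Λ_k) = Ω_k
— NODE 00's no-holes reading («the class of record = all scale-k cubes») recovered as the special case.
[cite: Balaban1985Variational, pp.278–279] -/
theorem isClassCube_top_iff (L k : ℕ) (Ω : ℕ → Set (B7Prop1Explicit.Site d)) (R₁ M₁ n : ℕ)
    (c : B7Prop1Explicit.Site d) :
    IsClassCube L k Ω R₁ M₁ k n c ↔ 1 ≤ n ∧ cubeEnlSet L R₁ M₁ k n c ⊆ Ω k := by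
  have hlayer : layer Ω k k = Ω k := by
    ext x
    simp only [layer, lt_self_iff_false, IsEmpty.forall_iff, and_true, Set.mem_setOf_eq]
  have htwo : twoLayers Ω k k = Ω k := by
    ext x
    simp only [twoLayers, hlayer, Set.mem_setOf_eq, add_le_iff_nonpos_right, nonpos_iff_eq_zero, one_ne_zero,
      false_and, or_false]
  simp only [IsClassCube, le_refl, true_and, htwo, add_le_iff_nonpos_right, nonpos_iff_eq_zero, one_ne_zero,
    false_and, not_false_eq_true, and_true]

/-- Non-vacuity: for the all-lattice sequence `Ω_j = T_η` (j ≤ k; the admitted case «some domains Ω_j are equal to T_η» of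
[6] p. 77, NODE 00's member) every scale-`k` cube with `n ≥ 1` is in the class.
[cite: Balaban1985Variational, pp.278–279; Balaban1985RegularSpaces, p.77] -/
theorem isClassCube_top_univ (L k : ℕ) (R₁ M₁ : ℕ) {n : ℕ} (hn : 1 ≤ n) (c : B7Prop1Explicit.Site d) :
    IsClassCube L k (fun m => if m ≤ k then (Set.univ : Set (B7Prop1Explicit.Site d)) else ∅) R₁ M₁ k n c := by
  rw [isClassCube_top_iff]
  refine ⟨hn, ?_⟩
  simp only [le_refl, ite_true, Set.subset_univ]

/-- **The cubes of the class as a TYPE** («We consider all cubes □ satisfying the above conditions»), with print's scale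
`j` and size parameter `M` — the data `Cube`, `scale`, `sizeM` that `B11.VarProblem` / `B11Eq7Convention.OtherData` leave
abstract, for the domain sequence `Ω` and the numerics `R₁, M₁` of (1). [cite: Balaban1985Variational, pp.278–279] -/
structure ClassCube (L k : ℕ) (Ω : ℕ → Set (B7Prop1Explicit.Site d)) (R₁ M₁ : ℕ) where
  /-- the scale `j` («for some j between 0 and k») -/
  j : ℕ
  /-- the multiplicity `n ≥ 1` of `M = n·R₁M₁` -/
  n : ℕ
  /-- the big-block index of the lower corner -/
  c : B7Prop1Explicit.Site d
  /-- membership in the class -/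
  mem : IsClassCube L k Ω R₁ M₁ j n c

namespace ClassCube

variable {L k : ℕ} {Ω : ℕ → Set (B7Prop1Explicit.Site d)} {R₁ M₁ : ℕ}

/-- The scale index `j` of □ (the `scale` of `B11.VarProblem`: `ξ = Lʲη`). [cite: Balaban1985Variational, p.279] -/
def scale (q : ClassCube L k Ω R₁ M₁) : ℕ := q.j

/-- The size parameter `M = n·R₁M₁` of □ («of a size 2MLʲη, M ≤ M(ε₁)»; the `sizeM` of `B11.VarProblem`).
[cite: Balaban1985Variational, Thm 1 p.279] -/
def sizeM (q : ClassCube L k Ω R₁ M₁) : ℝ := ((q.n * (R₁ * M₁) : ℕ) : ℝ)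

/-- □ as a set of fine sites. [cite: Balaban1985Variational, p.279] -/
def carrier (q : ClassCube L k Ω R₁ M₁) : Set (B7Prop1Explicit.Site d) := cubeSet L R₁ M₁ q.j q.n q.c

/-- □̃, the neighbourhood of □ on which the gauge transformation `u` of (9)–(10) is defined («defined on a neighborhood of
□»; Sect. F p. 301). [cite: Balaban1985Variational, Thm 1 p.279] -/
def nbhd (q : ClassCube L k Ω R₁ M₁) : Set (B7Prop1Explicit.Site d) := cubeEnlSet L R₁ M₁ q.j q.n q.c

/-- `scale ≤ k`. [cite: Balaban1985Variational, p.279] -/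
theorem scale_le (q : ClassCube L k Ω R₁ M₁) : q.scale ≤ k := q.mem.1

/-- □ ⊆ □̃. [cite: Balaban1985Variational, p.279] -/
theorem carrier_subset_nbhd (q : ClassCube L k Ω R₁ M₁) : q.carrier ⊆ q.nbhd :=
  cubeSet_subset_cubeEnlSet L R₁ M₁ q.j q.n q.c

/-- □̃ ⊆ Bʲ(Λ_j) ∪ B^{j+1}(Λ_{j+1}). [cite: Balaban1985Variational, p.279] -/
theorem nbhd_subset_twoLayers (q : ClassCube L k Ω R₁ M₁) : q.nbhd ⊆ twoLayers Ω k q.scale := q.mem.2.2.1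

/-- `M = n·R₁M₁ > 0` for the positive integers `R₁, M₁` of (1) («M is a multiple of R₁M₁», `n ≥ 1`).
[cite: Balaban1985Variational, p.279] -/
theorem sizeM_pos (hR : 0 < R₁) (hM : 0 < M₁) (q : ClassCube L k Ω R₁ M₁) : 0 < q.sizeM := by
  unfold sizeM
  exact_mod_cast Nat.mul_pos q.mem.2.1 (Nat.mul_pos hR hM)

/-- `R₁M₁ ≤ M` («M is a multiple of R₁M₁»; Sect. F p. 300 «In both cases M ≥ R₁M₁»). [cite: Balaban1985Variational, p.279] -/
theorem R₁M₁_le_sizeM (q : ClassCube L k Ω R₁ M₁) : ((R₁ * M₁ : ℕ) : ℝ) ≤ q.sizeM := by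
  unfold sizeM
  exact_mod_cast Nat.le_mul_of_pos_left (R₁ * M₁) q.mem.2.1

/-- □ is non-empty (`L ≥ 1`, `R₁, M₁ ≥ 1`). [cite: Balaban1985Variational, p.279] -/
theorem carrier_nonempty (hL : 0 < L) (hR : 0 < R₁) (hM : 0 < M₁) (q : ClassCube L k Ω R₁ M₁) : q.carrier.Nonempty :=
  ⟨_, cubeLo_mem_cubeSet hL hR hM q.mem.2.1 q.c⟩

end ClassCube

end CubeClass

/-! ## §2 The bundle keyed to the consumer `stmt-QuantumFields-19200` -/

section Bundle

variable {I : Type}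

/-- **THE BLOCK-11 BUNDLE** (carve rule 5): the printed ASSERTIONS of [B11] pp. 277–281 that carry a `Prop` name in the tree,
conjoined BY NAME over the tree's carriers — a family `fam : I → B11.VarProblem` of variational problems (5), (6) for fixed
(d, L) and their Sect. A–E descriptions `famLG : I → B11.LGData` around backgrounds U₀ with (14):
(i) **Theorem 1** p. 279 INCLUDING its last sentence «More exactly M(ε₁) = R₁M₁(a₁/ε₁)» — `B11Thm1Exact.Thm1PrintedExact
R₁M₁ fam` (row B11.Thm1; `R₁M₁` the fixed number of (1)); (ii) the remark after (7) p. 278 «by Proposition 2 [4] the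
configuration V satisfies (7) with ε₁ = O(ε₀)» — `B11.Prop2OfB7Shape fam` (row B11.Rem@278; a THEOREM at the concrete
family, `hyp_concrete`); (iii) **Proposition 2** p. 281 — `B11.Prop2Printed B₁ B₃ C₁ c₁ famLG` (row B11.Prop2; B₁, c₁ the
constants of [6] Thm 2, B₃ the constant (162) — the B₃ of Theorem 1 —, C₁ of (14)).  Every other printed item of the block is
a cited definition / theorem (module docstring).  Keyed to `stmt-QuantumFields-19200` (R3 `MinimiserStabilityRegPr`); also
feeds `stmt-QuantumFields-20541`, `-20520`.  A node prover takes `(h : Hyp R₁M₁ B₁ B₃ C₁ c₁ fam famLG)`; nothing is asserted.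
[cite: Balaban1985Variational, Thm 1 p.279, p.278 (remark after (7)), Prop. 2 p.281] -/
def Hyp (R₁M₁ B₁ B₃ C₁ c₁ : ℝ) (fam : I → B11.VarProblem) (famLG : I → B11.LGData) : Prop :=
  B11Thm1Exact.Thm1PrintedExact R₁M₁ fam ∧ B11.Prop2OfB7Shape fam ∧ B11.Prop2Printed B₁ B₃ C₁ c₁ famLG

variable {R₁M₁ B₁ B₃ C₁ c₁ : ℝ} {fam : I → B11.VarProblem} {famLG : I → B11.LGData}

/-- Unfolding of the bundle. [cite: Balaban1985Variational, Thm 1 p.279, Prop. 2 p.281] -/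
theorem hyp_iff : Hyp R₁M₁ B₁ B₃ C₁ c₁ fam famLG ↔
    B11Thm1Exact.Thm1PrintedExact R₁M₁ fam ∧ B11.Prop2OfB7Shape fam ∧ B11.Prop2Printed B₁ B₃ C₁ c₁ famLG :=
  Iff.rfl

/-- Projection: Theorem 1 with its printed ceiling `M(ε₁) = R₁M₁(a₁/ε₁)` (row B11.Thm1). [cite: Balaban1985Variational, Thm 1 p.279] -/
theorem Hyp.thm1Exact (h : Hyp R₁M₁ B₁ B₃ C₁ c₁ fam famLG) : B11Thm1Exact.Thm1PrintedExact R₁M₁ fam :=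
  h.1

/-- Projection: the remark after (7), ε₁ = O(ε₀) (row B11.Rem@278). [cite: Balaban1985Variational, p.278 (remark after (7))] -/
theorem Hyp.rem278 (h : Hyp R₁M₁ B₁ B₃ C₁ c₁ fam famLG) : B11.Prop2OfB7Shape fam :=
  h.2.1

/-- Projection: Proposition 2 (row B11.Prop2). [cite: Balaban1985Variational, Prop. 2 p.281] -/
theorem Hyp.prop2 (h : Hyp R₁M₁ B₁ B₃ C₁ c₁ fam famLG) : B11.Prop2Printed B₁ B₃ C₁ c₁ famLG :=
  h.2.2

/-- Derived: the tree's statement of record `B11.Thm1Printed fam` (the `∃ Mfun` form), by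
`B11Thm1Exact.thm1Printed_of_exact` (`R₁M₁ > 0`). [cite: Balaban1985Variational, Thm 1 p.279] -/
theorem Hyp.thm1Printed (h : Hyp R₁M₁ B₁ B₃ C₁ c₁ fam famLG) (hR : 0 < R₁M₁) : B11.Thm1Printed fam :=
  B11Thm1Exact.thm1Printed_of_exact hR fam h.1

/-- Derived: Theorem 1 AT ONE BLOCK OF CONSTANTS for every member (`B11Thm1.Thm1At`, the form the induction on k of
Sect. A is about), by `B11Thm1.thm1Printed_iff`. [cite: Balaban1985Variational, Thm 1 p.279] -/
theorem Hyp.thm1At (h : Hyp R₁M₁ B₁ B₃ C₁ c₁ fam famLG) (hR : 0 < R₁M₁) :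
    ∃ C : B11Thm1.Consts, ∀ i, B11Thm1.Thm1At C (fam i) :=
  (B11Thm1.thm1Printed_iff fam).1 (h.thm1Printed hR)

end Bundle

section Concrete

variable {𝔸 : Type} [NormedRing 𝔸] [NormOneClass 𝔸] [NormedAlgebra ℂ 𝔸] [CompleteSpace 𝔸]

/-- **At the concrete family the middle member is a theorem**: for the concrete model
`B11Eq7Convention.concreteVarProblem d 𝔸 L G X` of the carrier ((2), (3), (7) with bodies on `ℤᵈ`, index = the geometric
data `B11Eq7Convention.GeomDatum d L`), `L ≥ 2` and an averaging-closed gauge group `G` (`B7Prop2Explicit.AvgClosed`), the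
remark after (7) is the tree's `B11Rem278.prop2OfB7Shape_concrete`, so the bundle there is Theorem 1 ∧ Proposition 2.
[cite: Balaban1985Variational, p.278 (remark after (7)), Thm 1 p.279, Prop. 2 p.281] -/
theorem hyp_concrete (L : ℕ) (hL : 2 ≤ L) {G : Subgroup 𝔸ˣ} (hG : B7Prop2Explicit.AvgClosed d L G)
    (X : B11Eq7Convention.OtherData d 𝔸 G) {R₁M₁ B₁ B₃ C₁ c₁ : ℝ}
    {famLG : B11Eq7Convention.GeomDatum d L → B11.LGData}
    (h1 : B11Thm1Exact.Thm1PrintedExact R₁M₁ (B11Eq7Convention.concreteVarProblem d 𝔸 L G X))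
    (h2 : B11.Prop2Printed B₁ B₃ C₁ c₁ famLG) :
    Hyp R₁M₁ B₁ B₃ C₁ c₁ (B11Eq7Convention.concreteVarProblem d 𝔸 L G X) famLG :=
  ⟨h1, B11Rem278.prop2OfB7Shape_concrete L hL hG X, h2⟩

end Concrete

end Literature.MathematicalPhysics.QuantumFieldTheory.Balaban1983to89.B11Carve11IntroSectAHyp

/-! ## §4 Machine-checked index of the in-tree declarations cited for the 22 rows of block 11

`recall` (Mathlib) only resolves each constant; nothing is declared.  Modules of the `T3*` / `Node00/*` / `T4*` stems are
cited in the module docstring with file names but deliberately not imported here. -/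

namespace Literature.MathematicalPhysics.QuantumFieldTheory.Balaban1983to89

recall B8ConstraintBonds.DomainSeq                            -- B11.Eq1 (1)
recall B8ConstraintBonds.Lam                                  -- B11.Eq1 Λ_j
recall B8ConstraintBonds.Bk                                   -- B11.Eq1 𝔅_k
recall B8SectAStatements.MetricClause14                       -- B11.Eq1 metric clause of (1)
recall B8SectAStatements.metricClause14_anti                  -- B11.Eq1 «R ≥ R₁»
recall B8Eq134Admissible.Admissible134                        -- B11.Eq1 (1.3)–(1.4) of [6]
recall B8Ineq132.layer                                        -- B11.Eq1 Bʲ(Λ_j)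
recall B8Ineq132.BondTouches                                  -- p. 277 convention
recall B8Ineq132.PlaqTouches                                  -- p. 277 convention
recall B11Eq7Convention.Lam                                   -- B11.Eq1 (level coordinates)
recall B8Ineq132.InAk                                         -- B11.Eq2 (2)
recall B8Ineq132.inAk_gaugeAct_iff                            -- p. 278 «𝔘_k is gauge invariant»
recall B11Eq7Convention.InB                                   -- B11.Eq3 (3)
recall B8Eq113ClassBk.InBk                                    -- B11.Eq3 (3) ([6] (1.13))
recall B8Eq113ClassBk.inBkOn_gaugeAct_of_resGauge             -- p. 278 «𝔅_k(𝔅_k, V) is invariant …»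
recall B8ConstraintBonds.literal_not_Invariant                -- located gap G-adv8-10
recall B8ConstraintBonds.ResGauge                             -- B11.Eq4 (4)
recall B8Carve01SpacesHyp.resGaugeSubgroup                    -- p. 278 «These transformations form a group»
recall B8Carve01SpacesHyp.inAk_iff_of_orbitRel114             -- p. 278 «union of orbits»
recall wilsonAction4                                          -- B11.Eq5 (5) (torus)
recall B11Eq7Convention.concreteVarProblem                    -- B11.Eq6 (6)
recall B11Eq7Convention.effCfg                                -- B11.Eq7 convention of (7)
recall B11Eq7Convention.PlaqB                                 -- B11.Eq7
recall B11Eq7Convention.Reg7                                  -- B11.Eq7 (7)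
recall B11.Prop2OfB7Shape                                     -- B11.Rem@278 (shape)
recall B11Rem278.prop2OfB7Shape_concrete                      -- B11.Rem@278 (proved)
recall B11Rem278.reg7_of_nonempty                             -- B11.Rem@278 (proved, objects)
recall B11.VarProblem                                         -- B11.Def@278 (abstract Cube/scale/sizeM), B11.Eq2/Eq3/Eq7
recall IsBackground                                           -- B11.Def@279 U_k(V)
recall B11.Thm1Printed                                        -- B11.Thm1
recall B11.Regularity                                         -- B11.Thm1 (9)–(10)
recall B11Thm1Exact.Thm1PrintedExact                          -- B11.Thm1 with M(ε₁) = R₁M₁(a₁/ε₁)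
recall B11Thm1Exact.thm1Printed_of_exact                      -- B11.Thm1
recall B11Thm1.Ineq9                                          -- (9)
recall B11Thm1.Ineq10                                         -- (10)
recall B11Thm1.Exists8                                        -- (8)
recall B11Thm1.Unique6                                        -- Thm 1 uniqueness clause
recall B11Thm1.Reg910                                         -- Thm 1 regularity clause
recall B11Thm1.Thm1At                                         -- Thm 1 at given constants
recall B11Thm1.thm1Printed_iff                                -- bookkeeping
recall B11Thm1.thm1At_allLevels                               -- B11.Claim@279 induction on k
recall B11Thm1.StepA11                                        -- B11.Eq11 (11)
recall B11Thm1.StepA13                                        -- B11.Eq12 (12) ⇒ (13) (leaf)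
recall B11Eq13Concrete.step13                                 -- B11.Eq12 (proved)
recall B11Eq13Concrete.sat14_L3                               -- B11.Eq14 «with C₁ = L³»
recall B11Thm1.BaseK1                                         -- B11.Eq14 k = 1
recall B11Thm1.VarProblemA.Sat14                              -- (14)
recall B11.LGData                                             -- (14)–(21) abstract carrier
recall B8Lemma1NonAbelian.pert                                -- B11.Eq15 (15)
recall B8Eq119TwistedAxial.eq117                              -- B11.Eq15 (16) = [6] (1.17)
recall B8Eq119TwistedAxial.eq118                              -- B11.Eq15 (17) = [6] (1.18)
recall B11AxialTransport190.relAct                            -- B11.Eq15 (16)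
recall B11AxialTransport190.relAct_mul_bg                     -- (15)–(16)
recall B8Eq113ClassBk.Class128                                -- B11.Eq18 (18) on ℤᵈ ([6] (1.28))
recall B8Eq119TwistedAxial.InAx                               -- B11.Eq18 Ax_k(𝔅_k, U₀)
recall B8Eq119TwistedAxial.twistedFix_global                  -- p. 280 axial gauge fixing
recall B11Prop7Assembly.Bridge.Laws                           -- p. 280 reduction to (18) (`gaugeFix`), p. 281 «one-to-one» (`orbit16`)
recall B11.p280_landau_gauge_of_B8Thm2                        -- B11.Claim@280
recall B11Eq20BoundB.ineq135_of_inB                           -- p. 280 «(1.35) with α₁ = C₁ε₁»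
recall B8Eq119TwistedAxial.Restr129                           -- p. 281 «R̄₀uʲ = 1 on Λ_j»
recall B8Eq119TwistedAxial.restr129_level_zero                -- p. 281 «(thus u = 1 on Λ₀)»
recall B11Eq20BoundB.ineq20                                   -- B11.Eq19 «|B| < 2dLC₁ε₁»
recall B11.Prop2Printed                                       -- B11.Prop2
recall B11Prop7Assembly.silent_restrictions                   -- p. 280 standing smallness, as thresholds
recall B11.axial_critical_from_one_landau                     -- p. 281 «exactly one critical configuration»
recall B11.thm1_of_prop7_prop8_sectF                          -- B11.Claim@281
recall B11.Prop7Printed                                       -- p. 278/281 announcements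
recall B11.Prop9Printed                                       -- p. 279 «analytic functions of V»
recall B11Eq22Remainder.expRemainder                          -- B11.Eq22 R_n
recall B11Eq22Remainder.exp_eq_taylor_four                    -- (22)
recall B11Eq22Remainder.norm_expRemainder_I_smul_le_one       -- (23) first bound
recall B11Eq22Remainder.norm_expRemainder_le_exp_norm         -- (23) second bound

end Literature.MathematicalPhysics.QuantumFieldTheory.Balaban1983to89

end
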